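import Literature.AlgebraicGeometry.Resolution.AlterationsPreSemiStable
import Literature.AlgebraicGeometry.Resolution.SemiStableCurvesBaseChange
import Literature.AlgebraicGeometry.Resolution.BaseChangeOverOpens
import HarnessLib

/-!
# De Jong's alteration theorem, 4.22: pulling back the pointed semi-stable family along an alteration of the base

Topic: `Literature/AlgebraicGeometry/Resolution`. Proofs towards the discharge of the named fact
`DeJong1996PreSemiStablePairToSemiStablePair` (`AlterationsPreSemiStable.lean`; de Jong 1996, 4.22
from "At this point"):

> "At this point we apply the induction hypothesis: there exists a nonsingular projective variety
> `Y'` and a generically étale alteration `ψ : Y' → Y` such that the closed subset `ψ⁻¹(D)` is a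
> strict normal crossings divisor on `Y'`. Pulling back the family `𝒞` to a family `𝒳` over `Y'`
> and applying 4.4 once again, we reduce to the situation described in 4.23 below." (pp. 74–75)

Everything here is PROVED:

* `DeJong1996.ConclusionGenericallyEtale.exists_regular_projective_alteration` — the induction
  hypothesis for the pair `(Y, D)` with `Y` proper over `k`, in the form the text uses it: "there
  exists a nonsingular projective variety `Y'` and a generically étale alteration `ψ : Y' → Y`
  such that `ψ⁻¹(D)` is a strict normal crossings divisor" (the open immersion `j₁ : Y₁ → Ȳ₁` of
  Thm. 4.1 is an isomorphism since `Y₁` is proper, cf. 4.7; `ψ = j₁⁻¹ ∘ ψ₁`).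
* "Pulling back the family": for a pre-semi-stable pair `(𝒞 → Y, D, τ)`
  (`DeJong1996.PreSemiStablePair f g D τ`) and `ψ : Y' → Y` with `Y'` a nonsingular projective
  variety and `ψ⁻¹(D)` a strict normal crossings divisor, the family `𝒳 = 𝒞 ×_Y Y' → Y'` with the
  pulled-back sections `τ'ᵢ = (τᵢ ∘ ψ, 𝟙)` is in Situation 4.23 (`DeJong1996.SemiStablePair`,
  `PreSemiStablePair.semiStablePair_pullback`) as soon as `𝒳` is integral: semi-stability is
  `IsSemiStableCurve.baseChange` (Liu 2002, 10.3.15 (a)); smoothness over `Y' ∖ ψ⁻¹(D)`, the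
  sections, their disjointness and their smooth neighbourhoods are base changes along the
  cartesian squares over `𝒳 → 𝒞` (`BaseChangeOverOpens.lean`); projectivity of `𝒳` over `k` is
  `isProjectiveOver_pullback` (loc. cit.: the closed immersion `𝒞 ×_Y Y' ↪ 𝒞 ×_k Y'` followed by
  the Segre embedding).
* "applying 4.4 once again": `𝒳 → 𝒞` is an alteration, generically étale if `ψ` is
  (`PreSemiStablePair.isAlteration_fst`, `PreSemiStablePair.isGenericallyEtale_fst`: base change of
  the proper surjective generically finite `ψ` along the surjective `f`, étale over the preimage
  of the étale locus, which is dense in the irreducible `𝒳`), and the boundary of `𝒳` is the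
  preimage of the boundary of `𝒞` (`PreSemiStablePair.preimage_fst_semiStableBoundary`: the square
  `Y' → 𝒳 ← …` of a section is cartesian), so `DeJong1996.ConclusionGenericallyEtale.of_isAlteration`
  applies (`PreSemiStablePair.conclusionGenericallyEtale_of_pullback`).
* The assembly `DeJong1996PreSemiStablePairToSemiStablePair.of_pullback_isIntegral_of_dim`:
  the named fact follows from the two remaining pieces of bookkeeping, taken as hypotheses —
  the integrality of `𝒞 ×_Y Y'` (Liu 2002, Prop. 4.3.8: flat over the integral `Y'` with
  integral generic fibre) and the relative dimension `dim Y < dim 𝒞` of the curve `𝒞 → Y`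
  (needed to apply the induction hypothesis to `(Y, D)`).

## Sources

* A. J. de Jong, *Smoothness, semi-stability and alterations*, Publ. Math. IHÉS 83 (1996) 51–93:
  2.20, 2.22 (p. 61), 4.4, 4.7 (pp. 66–67), 4.22 (pp. 74–75), 4.23 (p. 75).
* Q. Liu, *Algebraic Geometry and Arithmetic Curves*, OUP (2002), Prop. 4.3.8, Prop. 10.3.15 (a).
-/

noncomputable section

open CategoryTheory CategoryTheory.Limits AlgebraicGeometry TopologicalSpace Topology

namespace Literature.AlgebraicGeometry.Resolution

universe u

/-! ## Alterations and isomorphisms -/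

/-- Precomposing an alteration with an isomorphism gives an alteration. [folklore] -/
theorem IsAlteration.iso_comp {X'' X' X : Scheme.{u}} (e : X'' ⟶ X') [IsIso e] {φ : X' ⟶ X}
    [IsIntegral X] (h : IsAlteration φ) : IsAlteration (e ≫ φ) :=
  haveI := h.isIntegral
  haveI : IsIntegral X'' := IsIntegral.of_isIso (inv e)
  (isAlteration_of_isIso e).comp h

/-- Precomposing a generically étale morphism of irreducible source with an isomorphism gives a
generically étale morphism. [folklore] -/
theorem IsGenericallyEtale.iso_comp {X'' X' X : Scheme.{u}} (e : X'' ⟶ X') [IsIso e]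
    {φ : X' ⟶ X} [IrreducibleSpace X''] (h : IsGenericallyEtale φ) :
    IsGenericallyEtale (e ≫ φ) :=
  (IsGenericallyEtale.of_etale e).comp h

namespace DeJong1996

/-! ## The induction hypothesis for a proper base: a nonsingular projective alteration -/

/-- **The induction hypothesis of 4.22 as used**: if Thm. 4.1 with its generically-étale clause
holds for the pair `(Y, D)` and `Y` is proper over `k`, then "there exists a nonsingular
projective variety `Y'` and a generically étale alteration `ψ : Y' → Y` such that the closed
subset `ψ⁻¹(D)` is a strict normal crossings divisor on `Y'`": in a solution
`(Y₁, Ȳ₁, ψ₁, j₁)` the open immersion `j₁` is proper with dense closed image in the irreducible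
`Ȳ₁`, hence an isomorphism, and `ψ = j₁⁻¹ ∘ ψ₁ : Ȳ₁ → Y` works (`ψ⁻¹(D) = j₁(ψ₁⁻¹(D))`, the
boundary `Ȳ₁ ∖ j₁(Y₁)` being empty). [cite: DeJong1996, 4.22, p. 74] -/
theorem ConclusionGenericallyEtale.exists_regular_projective_alteration {k : Type u} [Field k]
    {Y : Scheme.{u}} [IsIntegral Y] {g : Y ⟶ Spec (.of k)} [IsProper g] {D : Set Y}
    (h : ConclusionGenericallyEtale g D) :
    ∃ (Y' : Scheme.{u}) (ψ : Y' ⟶ Y), IsIntegral Y' ∧ IsAlteration ψ ∧ IsGenericallyEtale ψ ∧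
      Literature.AlgebraicGeometry.Motives.IsProjectiveOver (Over.mk (ψ ≫ g)) ∧
        Scheme.IsRegular Y' ∧ IsStrictNormalCrossingsDivisor Y' (ψ ⁻¹' D) := by
  obtain ⟨Y₁, Ybar, ψ₁, j₁, gbar, hψ, hj, hint, hproj, hreg, hcomm, hsnc, het⟩ := h
  haveI := hψ.isIntegral
  haveI := hψ.isProper
  haveI := hj
  haveI := hint
  haveI : IsProper gbar := Motives.IsProjectiveOver.isProper hproj
  -- `j₁` is proper, with closed and open non-empty range in the irreducible `Ȳ₁`: an isomorphism
  haveI : IsProper (j₁ ≫ gbar) := by rw [hcomm]; infer_instance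
  haveI : IsProper j₁ := IsProper.of_comp j₁ gbar
  have hrange : Set.range j₁ = Set.univ := by
    have hcl : IsClosed (Set.range j₁) := j₁.isClosedMap.isClosed_range
    have hne : (Set.range j₁).Nonempty := ⟨_, ⟨Classical.arbitrary Y₁, rfl⟩⟩
    have hdense : Dense (Set.range j₁) := j₁.isOpenEmbedding.isOpen_range.dense hne
    rw [← hdense.closure_eq, hcl.closure_eq]
  haveI : IsIso j₁ := by
    haveI : Epi j₁.base := (TopCat.epi_iff_surjective _).mpr (Set.range_eq_univ.mp hrange)
    exact IsOpenImmersion.isIso j₁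
  refine ⟨Ybar, inv j₁ ≫ ψ₁, hint, hψ.iso_comp (inv j₁), het.iso_comp (inv j₁), ?_, hreg, ?_⟩
  · have hg : (inv j₁ ≫ ψ₁) ≫ g = gbar := by rw [Category.assoc, ← hcomm, IsIso.inv_hom_id_assoc]
    rw [hg]
    exact hproj
  · have hcompl : (Set.range j₁)ᶜ = ∅ := by rw [hrange, Set.compl_univ]
    rw [hcompl, Set.union_empty] at hsnc
    have hpre : ((inv j₁ ≫ ψ₁) ⁻¹' D : Set Ybar) = j₁ '' (ψ₁ ⁻¹' D) := by
      ext y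
      constructor
      · intro hy
        refine ⟨inv j₁ y, by simpa [Set.mem_preimage, Scheme.Hom.comp_apply] using hy, ?_⟩
        rw [← Scheme.Hom.comp_apply, IsIso.inv_hom_id]
        rfl
      · rintro ⟨x, hx, rfl⟩
        show (inv j₁ ≫ ψ₁) (j₁ x) ∈ D
        rw [← Scheme.Hom.comp_apply, IsIso.hom_inv_id_assoc]
        exact hx
    rwa [hpre]

/-! ## Pulling back the family along a morphism of the base -/

namespace PreSemiStablePair

variable {k : Type u} [Field k] {X Y Y' : Scheme.{u}} {f : X ⟶ Y} {g : Y ⟶ Spec (.of k)}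
  {D : Set Y} {n : ℕ} {τ : Fin n → (Y ⟶ X)}

/-- In the situation of 4.22, `Y → Spec k` is proper. [folklore] -/
theorem isProper_base (h : PreSemiStablePair f g D τ) : IsProper g :=
  Literature.AlgebraicGeometry.Motives.IsProjectiveOver.isProper (X := Over.mk g)
    h.isProjectiveOver_base

/-- The pulled-back sections `τ'ᵢ = (τᵢ ∘ ψ, 𝟙) : Y' → 𝒞 ×_Y Y'` of a family with sections
`τᵢ` (de Jong 1996, 2.22/4.22: "Pulling back the family"). [cite: DeJong1996, 4.22, p. 75] -/
def pullbackSection (hτ : ∀ i, τ i ≫ f = 𝟙 Y) (ψ : Y' ⟶ Y) (i : Fin n) :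
    Y' ⟶ pullback f ψ :=
  pullback.lift (ψ ≫ τ i) (𝟙 Y') (by rw [Category.assoc, hτ i, Category.comp_id, Category.id_comp])

omit [Field k] in
/-- The pulled-back section followed by the projection to `𝒞` is `τᵢ ∘ ψ`. [folklore] -/
@[simp]
theorem pullbackSection_fst (hτ : ∀ i, τ i ≫ f = 𝟙 Y) (ψ : Y' ⟶ Y) (i : Fin n) :
    pullbackSection hτ ψ i ≫ pullback.fst f ψ = ψ ≫ τ i :=
  pullback.lift_fst _ _ _

omit [Field k] in
/-- The pulled-back section is a section of `f' : 𝒞 ×_Y Y' → Y'`. [folklore] -/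
@[simp]
theorem pullbackSection_snd (hτ : ∀ i, τ i ≫ f = 𝟙 Y) (ψ : Y' ⟶ Y) (i : Fin n) :
    pullbackSection hτ ψ i ≫ pullback.snd f ψ = 𝟙 Y' :=
  pullback.lift_snd _ _ _

omit [Field k] in
/-- The square formed by a section `τᵢ : Y → 𝒞`, its pull-back `τ'ᵢ : Y' → 𝒞 ×_Y Y'`, `ψ` and the
projection `𝒞 ×_Y Y' → 𝒞` is cartesian (`Y ×_𝒞 (𝒞 ×_Y Y') = Y ×_Y Y' = Y'`). [folklore] -/
theorem isPullback_pullbackSection (hτ : ∀ i, τ i ≫ f = 𝟙 Y) (ψ : Y' ⟶ Y) (i : Fin n) :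
    IsPullback (pullbackSection hτ ψ i) ψ (pullback.fst f ψ) (τ i) := by
  have H : IsPullback (pullback.snd f ψ) (pullback.fst f ψ) ψ f := (IsPullback.of_hasPullback f ψ).flip
  refine IsPullback.of_right (h₁₂ := pullback.snd f ψ) (h₂₂ := f) (v₁₃ := ψ) ?_ (by simp) H
  rw [pullbackSection_snd, hτ i]
  exact IsPullback.of_horiz_isIso ⟨by simp⟩

omit [Field k] in
/-- The image of a pulled-back section is the preimage of the image of the section.
[folklore] -/
theorem range_pullbackSection (hτ : ∀ i, τ i ≫ f = 𝟙 Y) (ψ : Y' ⟶ Y) (i : Fin n) :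
    Set.range (pullbackSection hτ ψ i) = pullback.fst f ψ ⁻¹' Set.range (τ i) := by
  have H := isPullback_pullbackSection hτ ψ i
  have e : pullbackSection hτ ψ i = H.isoPullback.hom ≫ pullback.fst (pullback.fst f ψ) (τ i) :=
    (H.isoPullback_hom_fst).symm
  have hs : Function.Surjective H.isoPullback.hom := H.isoPullback.hom.surjective
  rw [e, Scheme.Hom.comp_base, TopCat.coe_comp, Set.range_comp, Set.range_eq_univ.mpr hs,
    Set.image_univ, Scheme.Pullback.range_fst]

omit [Field k] in
/-- **The boundary pulls back to the boundary**: `pr⁻¹(⋃ᵢ τᵢ(Y) ∪ f⁻¹(D)) = ⋃ᵢ τ'ᵢ(Y') ∪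
f'⁻¹(ψ⁻¹(D))` for the family `f' : 𝒞 ×_Y Y' → Y'` with its pulled-back sections.
[cite: DeJong1996, 4.22, p. 75] -/
theorem preimage_fst_semiStableBoundary (hτ : ∀ i, τ i ≫ f = 𝟙 Y) (ψ : Y' ⟶ Y) :
    pullback.fst f ψ ⁻¹' semiStableBoundary f D τ =
      semiStableBoundary (pullback.snd f ψ) (ψ ⁻¹' D) (pullbackSection hτ ψ) := by
  ext x
  simp only [semiStableBoundary, Set.preimage_union, Set.preimage_iUnion, Set.mem_union,
    Set.mem_iUnion, range_pullbackSection, Set.mem_preimage]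
  rw [← Scheme.Hom.comp_apply, ← Scheme.Hom.comp_apply, pullback.condition]

/-- **"Pulling back the family `𝒞` to a family `𝒳` over `Y'`" lands in Situation 4.23** (de Jong
1996, 4.22): for a pre-semi-stable pair `(𝒞 → Y, D, τ)` and `ψ : Y' → Y` with `Y'` a
nonsingular projective variety over `k` and `ψ⁻¹(D)` a strict normal crossings divisor, the
family `𝒳 = 𝒞 ×_Y Y' → Y'` with the sections `τ'ᵢ = (τᵢ ∘ ψ, 𝟙)` and the divisor `ψ⁻¹(D)` is a
semi-stable pair, provided `𝒳` is integral: `f'` is a semi-stable curve (base change, Liu 2002,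
10.3.15 (a)), smooth over `Y' ∖ ψ⁻¹(D)` (base change), the `τ'ᵢ` are disjoint sections into
the smooth locus (base change along the cartesian squares over `𝒳 → 𝒞`), and `𝒳` is projective
over `k` (`isProjectiveOver_pullback`, `BaseChangeOverOpens.lean`). [cite: DeJong1996, 4.22, p. 75] -/
theorem semiStablePair_pullback (h : PreSemiStablePair f g D τ) (ψ : Y' ⟶ Y) [IsIntegral Y']
    (hY' : Literature.AlgebraicGeometry.Motives.IsProjectiveOver (Over.mk (ψ ≫ g)))
    (hreg : Scheme.IsRegular Y') (hD : IsStrictNormalCrossingsDivisor Y' (ψ ⁻¹' D))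
    [IsIntegral (pullback f ψ)] :
    SemiStablePair (pullback.snd f ψ) (ψ ≫ g) (ψ ⁻¹' D) (pullbackSection h.comp_eq_id ψ) := by
  haveI := h.isIntegral
  haveI := h.isIntegral_base
  haveI := h.isProper_base
  haveI : IsSeparated g := inferInstance
  refine
    { isIntegral := ‹_›
      isProjectiveOver := isProjectiveOver_pullback f g ψ (ψ ≫ g) rfl h.isProjectiveOver hY'
      isIntegral_base := ‹_›
      isProjectiveOver_base := hY'
      isRegular_base := hreg
      isStrictNormalCrossingsDivisor := hD
      isSemiStableCurve := h.isSemiStableCurve.baseChange ψ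
      smooth_morphismRestrict := ?_
      comp_eq_id := fun i => pullbackSection_snd h.comp_eq_id ψ i
      pairwise_disjoint := ?_
      exists_smooth := ?_ }
  · -- smoothness over `Y' ∖ ψ⁻¹(D) = ψ⁻¹(Y ∖ D)`: a base change of `f` over `Y ∖ D`
    let U : Y.Opens := ⟨Dᶜ, h.isClosed.isOpen_compl⟩
    have hV : (⟨(ψ ⁻¹' D)ᶜ, hD.isClosed.isOpen_compl⟩ : Y'.Opens) = ψ ⁻¹ᵁ U := rfl
    rw [hV]
    -- `f` is smooth on `f⁻¹(U)`
    have hfU : Smooth ((f ⁻¹ᵁ U).ι ≫ f) := by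
      rw [← morphismRestrict_ι]
      haveI := h.smooth_morphismRestrict
      infer_instance
    have h1 := ι_comp_pullback_snd_of_ι_comp (P := @Smooth) f ψ (f ⁻¹ᵁ U) hfU
    have he : pullback.fst f ψ ⁻¹ᵁ (f ⁻¹ᵁ U) = pullback.snd f ψ ⁻¹ᵁ (ψ ⁻¹ᵁ U) := by
      rw [← Scheme.Hom.comp_preimage, ← Scheme.Hom.comp_preimage, pullback.condition]
    rw [he] at h1
    rw [← morphismRestrict_ι] at h1
    exact MorphismProperty.of_postcomp (W := @Smooth) (W' := @IsOpenImmersion) _ (ψ ⁻¹ᵁ U).ι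
      inferInstance h1
  · intro i j hij
    refine Set.disjoint_left.mpr ?_
    rintro x ⟨y, rfl⟩ ⟨y', hy'⟩
    have h1 : pullback.fst f ψ (pullbackSection h.comp_eq_id ψ i y) ∈ Set.range (τ i) := by
      rw [← Scheme.Hom.comp_apply, pullbackSection_fst]
      exact ⟨ψ y, rfl⟩
    have h2 : pullback.fst f ψ (pullbackSection h.comp_eq_id ψ j y') ∈ Set.range (τ j) := by
      rw [← Scheme.Hom.comp_apply, pullbackSection_fst]
      exact ⟨ψ y', rfl⟩
    rw [hy'] at h2
    exact Set.disjoint_left.mp (h.pairwise_disjoint hij) h1 h2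
  · intro i
    obtain ⟨U, hU, hsm⟩ := h.exists_smooth i
    refine ⟨pullback.fst f ψ ⁻¹ᵁ U, ?_, ι_comp_pullback_snd_of_ι_comp (P := @Smooth) f ψ U hsm⟩
    rintro _ ⟨y, rfl⟩
    show pullback.fst f ψ (pullbackSection h.comp_eq_id ψ i y) ∈ U
    rw [← Scheme.Hom.comp_apply, pullbackSection_fst]
    exact hU ⟨ψ y, rfl⟩

/-! ## The projection `𝒞 ×_Y Y' → 𝒞` is a generically étale alteration -/

/-- **`𝒳 = 𝒞 ×_Y Y' → 𝒞` is an alteration** (de Jong 1996, 4.22 with 2.20): it is proper and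
surjective as a base change of the proper surjective `ψ`, finite over `f⁻¹(V)` if `ψ` is finite
over `V` — a non-empty open, `f` being surjective (its geometric fibres are non-empty) —, and
`𝒳` is integral by hypothesis. [cite: DeJong1996, 4.22, p. 75] -/
theorem isAlteration_fst (h : PreSemiStablePair f g D τ) {ψ : Y' ⟶ Y} (hψ : IsAlteration ψ)
    [IsIntegral (pullback f ψ)] : IsAlteration (pullback.fst f ψ) := by
  haveI := h.isIntegral
  haveI := h.isIntegral_base
  haveI := hψ.isProper
  haveI : Surjective ψ := hψ.surjective
  refine ⟨‹_›, inferInstance, inferInstance, ?_⟩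
  obtain ⟨V, hV, hfin⟩ := hψ.exists_isFinite
  haveI := hfin
  refine ⟨f ⁻¹ᵁ V, ?_,
    morphismRestrict_pullback_fst_of_morphismRestrict (P := @IsFinite) f ψ V inferInstance⟩
  -- `f` is surjective: the geometric fibre over any point is connected, hence non-empty
  obtain ⟨y, hy⟩ := hV
  let K : Type u := AlgebraicClosure (Y.residueField y)
  let s : Spec (.of K) ⟶ Y :=
    Spec.map (CommRingCat.ofHom (algebraMap (Y.residueField y) K)) ≫ Y.fromSpecResidueField y
  haveI := h.isSemiStableCurve.connectedSpace_pullback K s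
  obtain ⟨z⟩ := (inferInstance : Nonempty ↥(pullback f s))
  refine ⟨pullback.fst f s z, ?_⟩
  show f (pullback.fst f s z) ∈ V
  rw [← Scheme.Hom.comp_apply, pullback.condition, Scheme.Hom.comp_apply]
  have hs : ∀ t : Spec (.of K), s t = y := fun t => by
    simp only [s, Scheme.Hom.comp_apply]
    exact Scheme.fromSpecResidueField_apply y _
  rw [hs]
  exact hy

/-- **`𝒳 = 𝒞 ×_Y Y' → 𝒞` is generically étale if `ψ` is** (de Jong 1996, 4.22 with 4.4): it is
étale on the preimage of the dense open of `Y'` where `ψ` is étale, a non-empty open of the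
irreducible `𝒳`. [cite: DeJong1996, 4.22, p. 75] -/
theorem isGenericallyEtale_fst (h : PreSemiStablePair f g D τ) {ψ : Y' ⟶ Y}
    (hψe : IsGenericallyEtale ψ) [IsIntegral (pullback f ψ)] :
    IsGenericallyEtale (pullback.fst f ψ) := by
  haveI := h.isIntegral
  haveI := h.isIntegral_base
  obtain ⟨W, hW, hWet⟩ := hψe
  haveI := hWet
  -- `f' = pullback.snd` is surjective (base change of the surjective `f`), so `f'⁻¹(W) ≠ ∅`
  haveI : Surjective f := by
    refine ⟨fun y => ?_⟩
    let K : Type u := AlgebraicClosure (Y.residueField y)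
    let s : Spec (.of K) ⟶ Y :=
      Spec.map (CommRingCat.ofHom (algebraMap (Y.residueField y) K)) ≫ Y.fromSpecResidueField y
    haveI := h.isSemiStableCurve.connectedSpace_pullback K s
    obtain ⟨z⟩ := (inferInstance : Nonempty ↥(pullback f s))
    refine ⟨pullback.fst f s z, ?_⟩
    rw [← Scheme.Hom.comp_apply, pullback.condition, Scheme.Hom.comp_apply]
    exact Scheme.fromSpecResidueField_apply y _
  have hne : ((pullback.snd f ψ ⁻¹ᵁ W : (pullback f ψ).Opens) : Set ↥(pullback f ψ)).Nonempty := by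
    haveI : Nonempty Y' := ⟨pullback.snd f ψ (Classical.arbitrary _)⟩
    obtain ⟨w, hw⟩ := hW.nonempty
    obtain ⟨x, hx⟩ := (pullback.snd f ψ).surjective w
    exact ⟨x, show pullback.snd f ψ x ∈ W by rw [hx]; exact hw⟩
  refine ⟨pullback.snd f ψ ⁻¹ᵁ W, (pullback.snd f ψ ⁻¹ᵁ W).2.dense hne, ?_⟩
  -- `f'⁻¹(W) → 𝒞` is the base change of the étale `W → Y'` along `f`
  exact ι_comp_pullback_fst_of_ι_comp (P := @Etale) f ψ W (inferInstance : Etale (W.ι ≫ ψ))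

/-- **"applying 4.4 once again"** (de Jong 1996, 4.22): Thm. 4.1 with its generically-étale
clause for the pulled-back family `(𝒳 → Y', ψ⁻¹(D), τ')` gives it for `(𝒞 → Y, D, τ)`, along the
generically étale alteration `𝒳 → 𝒞`, whose preimage of the boundary is the boundary.
[cite: DeJong1996, 4.22, p. 75] -/
theorem conclusionGenericallyEtale_of_pullback (h : PreSemiStablePair f g D τ) {ψ : Y' ⟶ Y}
    (hψ : IsAlteration ψ) (hψe : IsGenericallyEtale ψ) [IsIntegral (pullback f ψ)]
    (H : ConclusionGenericallyEtale (pullback.snd f ψ ≫ ψ ≫ g)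
      (semiStableBoundary (pullback.snd f ψ) (ψ ⁻¹' D) (pullbackSection h.comp_eq_id ψ))) :
    ConclusionGenericallyEtale (f ≫ g) (semiStableBoundary f D τ) := by
  haveI := h.isIntegral
  refine ConclusionGenericallyEtale.of_isAlteration (h.isAlteration_fst hψ)
    (h.isGenericallyEtale_fst hψe) ?_
  rw [preimage_fst_semiStableBoundary h.comp_eq_id ψ, ← Category.assoc, pullback.condition,
    Category.assoc]
  exact H

/-- The dimension of the pulled-back family is that of `𝒞` (2.20). [folklore] -/
theorem topologicalKrullDim_pullback (h : PreSemiStablePair f g D τ) {ψ : Y' ⟶ Y}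
    (hψ : IsAlteration ψ) [IsIntegral (pullback f ψ)] :
    topologicalKrullDim ↥(pullback f ψ) = topologicalKrullDim X := by
  haveI := h.isIntegral
  haveI := h.locallyOfFiniteType
  exact (h.isAlteration_fst hψ).topologicalKrullDim_eq (f ≫ g)

end PreSemiStablePair

end DeJong1996

/-! ## The assembly: 4.22 from the two remaining pieces of bookkeeping -/

/-- Dimension bookkeeping in `WithBot ℕ∞`: `a < d + 1` gives `a ≤ d`. [folklore] -/
theorem WithBot.ENat.le_of_lt_succ {a : WithBot ℕ∞} {d : ℕ} (h : a < ((d + 1 : ℕ) : WithBot ℕ∞)) :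
    a ≤ d := by
  induction a using WithBot.recBotCoe with
  | bot => exact bot_le
  | coe a =>
    induction a using ENat.recTopCoe with
    | top => exact absurd h (by exact_mod_cast not_top_lt)
    | coe a =>
      have : a < d + 1 := by exact_mod_cast h
      exact_mod_cast Nat.lt_succ_iff.mp this

/-- **de Jong 1996, 4.22 from "At this point" (`DeJong1996PreSemiStablePairToSemiStablePair`),
reduced to two pieces of bookkeeping**, taken as hypotheses: (a) the integrality of the
pulled-back family `𝒞 ×_Y Y'` along an alteration `Y' → Y` of the base (Liu 2002, Prop. 4.3.8:
flat over the integral `Y'` with integral generic fibre — a smooth geometrically connected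
curve), and (b) the relative dimension `dim Y < dim 𝒞` of the curve `𝒞 → Y` (so that the
induction hypothesis in dimension `≤ d` applies to `(Y, D)` when `dim 𝒞 = d + 1`). Given these,
the induction hypothesis yields a nonsingular projective `Y'` and a generically étale alteration
`ψ : Y' → Y` with `ψ⁻¹(D)` strict normal crossings
(`ConclusionGenericallyEtale.exists_regular_projective_alteration`), the pulled-back family is a
semi-stable pair of the same dimension (`PreSemiStablePair.semiStablePair_pullback`,
`topologicalKrullDim_pullback`), and 4.4 descends its resolution
(`PreSemiStablePair.conclusionGenericallyEtale_of_pullback`). [cite: DeJong1996, 4.22, pp. 74–75] -/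
theorem DeJong1996PreSemiStablePairToSemiStablePair.of_pullback_isIntegral_of_dim
    (hint : ∀ {k : Type u} [Field k] [IsAlgClosed k] {X Y Y' : Scheme.{u}} {f : X ⟶ Y}
      {g : Y ⟶ Spec (.of k)} {D : Set Y} {n : ℕ} {τ : Fin n → (Y ⟶ X)} (ψ : Y' ⟶ Y),
      DeJong1996.PreSemiStablePair f g D τ → IsIntegral Y' → IsAlteration ψ →
        IsGenericallyEtale ψ → IsIntegral (pullback f ψ))
    (hdim : ∀ {k : Type u} [Field k] [IsAlgClosed k] {X Y : Scheme.{u}} {f : X ⟶ Y}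
      {g : Y ⟶ Spec (.of k)} {D : Set Y} {n : ℕ} {τ : Fin n → (Y ⟶ X)},
      DeJong1996.PreSemiStablePair f g D τ → topologicalKrullDim Y < topologicalKrullDim X) :
    DeJong1996PreSemiStablePairToSemiStablePair.{u} := by
  intro k _ _ d ih X Y f g D n τ hP hdimX H
  haveI := hP.isIntegral
  haveI := hP.isIntegral_base
  haveI := hP.isProper_base
  -- the induction hypothesis for `(Y, D)`: `dim Y ≤ d`
  have hdimY : topologicalKrullDim Y ≤ d :=
    WithBot.ENat.le_of_lt_succ (lt_of_lt_of_eq (hdim hP) hdimX)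
  have hY : DeJong1996.ConclusionGenericallyEtale g D :=
    ih Y g D inferInstance inferInstance inferInstance hP.isIntegral_base hdimY hP.isClosed hP.ne_univ
  obtain ⟨Y', ψ, hY'int, hψ, hψe, hproj, hreg, hsnc⟩ := hY.exists_regular_projective_alteration
  haveI := hY'int
  haveI : IsIntegral (pullback f ψ) := hint ψ hP hY'int hψ hψe
  -- the pulled-back family is a semi-stable pair of the same dimension; apply 4.4
  refine hP.conclusionGenericallyEtale_of_pullback hψ hψe ?_
  exact H _ Y' (pullback.snd f ψ) (ψ ≫ g) (ψ ⁻¹' D) n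
    (DeJong1996.PreSemiStablePair.pullbackSection hP.comp_eq_id ψ)
    (hP.semiStablePair_pullback ψ hproj hreg hsnc) (hP.topologicalKrullDim_pullback hψ)

end Literature.AlgebraicGeometry.Resolution

end
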